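import Literature.NumberTheory.Automorphic.LocalOrbitalMeasureSemisimple        -- ★ `exists_orbitalMeasureFamily_of_isMulRightInvariant`, `isMulRightInvariant_subgroup_of_eq_top`
import Literature.NumberTheory.Automorphic.LocalUnitaryGroupUnimodularIsotropic  -- ★ `modularCharacter_cmDatum_local_antidiagOne_eq_one` (the quasi-split `U(Φ_N)(L⁺_v)` is unimodular)
import Literature.NumberTheory.Rogawski1990.LocalTransferFundamentalLemma        -- ★ `OrbitalMeasureFamily.IsAdmissibleOn`
import Literature.MeasureTheory.Group.HaarUnionCompactSubgroups                  -- ★ p849098 `isMulRightInvariant_of_forall_mem_isCompact_subgroup`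
import HarnessLib

/-!
# Invariant orbital measures EXIST at the unipotent classes of `U(Φ₃)(L⁺_v)` — the existence half of Ranga Rao's theorem, from
# unimodularity of the centralisers
(Ranga Rao (1972), Thm. p. 505 (existence half); Rogawski (1990), §4.9 p. 54, §8.1 p. 112; Deitmar–Echterhoff (2014), Thm. 1.5.3)

Topic `NumberTheory/Rogawski1990`; namespaces `Literature.NumberTheory.Automorphic` (§1, generic) and `Literature.NumberTheory.Rogawski1990` (§2–§3).
THEOREMS ONLY (no def, no instance, no named fact, no `sorry`).

The orbital integral `Φ(u, f) = ∫_{G ⧸ G_u} f(y u y⁻¹) dμ_u(y)` at a unipotent `u` needs an invariant Radon measure `μ_u ≠ 0` on `G ⧸ G_u`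
(`OrbitalMeasureFamily.IsAdmissibleOn`: non-zero, `G`-invariant, finite on compacts).  By ★ `InvariantQuotientExistence` (Deitmar–Echterhoff
Thm. 1.5.3, packaged as ★ `exists_orbitalMeasureFamily_of_isMulRightInvariant`) such a measure exists as soon as `G` and `G_u` are unimodular.
For `u ≠ 1` unipotent in `G = U(Φ₃)(L⁺_v)` the centraliser `G_u` is a union of compact subgroups (compact torus ⋉ unipotent), hence unimodular by
★ `isMulRightInvariant_of_forall_mem_isCompact_subgroup`; `G` itself is unimodular (★ `modularCharacter_cmDatum_local_antidiagOne_eq_one`).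

* §1 GENERIC **`exists_orbitalMeasureFamily_isAdmissibleOn_of_forall_mem_isCompact_subgroup`**: `G` unimodular (`Δ_G ≡ 1`), `P` a predicate such that
  every element of the centraliser of every `P`-element `γ ≠ 1` lies in a compact subgroup ⇒ an orbital-measure family admissible on `P` (regular members).
* §2 **`UnitaryGroup.exists_orbitalMeasureFamily_isAdmissibleOn_unipotent_antidiagOne_three`**: the `U(Φ₃)(L⁺_v)` dress at EVERY finite place `v`, with the
  centraliser property as a HYPOTHESIS `hcent` (discharged at the non-split places by the companion file `UnitaryThreeUnipotentCentralizerBounded`).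
* §3 **`UnitaryGroup.exists_orbitalMeasureFamily_isAdmissibleOn_unipotent_antidiagOne_three_odd`**: the same in the binder prefix of the Shalika
  pay-down organ `stub_ShRao` (odd non-split place; the extra binders are idle for existence).
HC_CM is proved only modulo the printed citations until rung 0 closes; this file discharges none of them (it is the existence half of the
in-house organ ‹RAO›; the convergence half — Ranga Rao's clause — is separate).

## References
* [Rao1972] R. Ranga Rao, *Orbital integrals in reductive groups*, Ann. of Math. (2) 96 (1972) 505–510, Theorem (existence of the invariant measure).
* [Rogawski1990] J. D. Rogawski, *Automorphic Representations of Unitary Groups in Three Variables*, Ann. of Math. Stud. 123 (1990), §4.9 p. 54; §8.1 p. 112.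
* [DeitmarEchterhoff2014] A. Deitmar, S. Echterhoff, *Principles of Harmonic Analysis*, 2nd ed. (2014), Thm. 1.5.3.
-/

noncomputable section

open MeasureTheory Measure NumberField IsDedekindDomain Topology ValuativeRel
open Literature.MeasureTheory.Group
open scoped Matrix MatrixGroups ValuativeRel

namespace Literature.NumberTheory.Automorphic

/-! ## §1 Generic: admissible orbital measures at the classes whose centralisers are unions of compact subgroups -/

section Algebra

variable {G : Type*} [Group G]

/-- The centraliser of `1` is everything. [folklore] -/
private theorem centralizer_singleton_one_eq_top : Subgroup.centralizer ({(1 : G)} : Set G) = ⊤ :=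
  (Subgroup.eq_top_iff' _).2 fun g => Subgroup.mem_centralizer_singleton_iff.2 (by rw [mul_one, one_mul])

end Algebra

section Generic

variable {G : Type*} [Group G] [TopologicalSpace G] [IsTopologicalGroup G] [LocallyCompactSpace G] [SecondCountableTopology G] [T2Space G]
  [MeasurableSpace G] [BorelSpace G]

/-- **Every Haar measure on the centraliser `G_γ` is right invariant** when `G` is unimodular and either `γ = 1` or every element of `G_γ` lies in a
compact subgroup of `G_γ` (★ `isMulRightInvariant_of_forall_mem_isCompact_subgroup`; `γ = 1`: `G_1 = G`, ★ `isMulRightInvariant_subgroup_of_eq_top`).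
[cite: DeitmarEchterhoff2014, Thm. 1.5.3] [cite: Rao1972, Theorem] -/
theorem isMulRightInvariant_centralizer_of_forall_mem_isCompact_subgroup (hG : ∀ g : G, modularCharacterFun g = 1) (γ : G)
    (hγ : γ ≠ 1 → ∀ g : ↥(Subgroup.centralizer ({γ} : Set G)),
      ∃ K : Subgroup ↥(Subgroup.centralizer ({γ} : Set G)), IsCompact (K : Set ↥(Subgroup.centralizer ({γ} : Set G))) ∧ g ∈ K)
    (ρ : Measure ↥(Subgroup.centralizer ({γ} : Set G))) [ρ.IsHaarMeasure] : ρ.IsMulRightInvariant := by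
  by_cases h1 : γ = 1
  · subst h1
    exact isMulRightInvariant_subgroup_of_eq_top _ centralizer_singleton_one_eq_top hG ρ
  · haveI : LocallyCompactSpace ↥(Subgroup.centralizer ({γ} : Set G)) :=
      (isClosed_coe_centralizer_singleton γ).isClosedEmbedding_subtypeVal.locallyCompactSpace
    exact isMulRightInvariant_of_forall_mem_isCompact_subgroup ρ (hγ h1)

/-- **Admissible orbital measures at the classes whose centralisers are unions of compact subgroups** (existence half of Ranga Rao's theorem in the
shape the tree's unipotent classes have): `G` locally compact second countable Hausdorff and UNIMODULAR (`Δ_G ≡ 1`), `P` a predicate on `G` such that every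
element of the centraliser of every `P`-element `γ ≠ 1` lies in a compact subgroup of the centraliser ⇒ there is an orbital-measure family `m` ADMISSIBLE ON
`P` — `m_c ≠ 0`, `G`-invariant, finite on compacts at every class `c` with `P (out c)` — whose members there are moreover regular.  (★
`exists_orbitalMeasureFamily_of_isMulRightInvariant` = Deitmar–Echterhoff Thm. 1.5.3 per class, with the centraliser Haar measures right invariant by
`isMulRightInvariant_centralizer_of_forall_mem_isCompact_subgroup`.) [cite: Rao1972, Theorem] [cite: DeitmarEchterhoff2014, Thm. 1.5.3] -/
theorem exists_orbitalMeasureFamily_isAdmissibleOn_of_forall_mem_isCompact_subgroup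
    [∀ γ : G, MeasurableSpace (G ⧸ Subgroup.centralizer ({γ} : Set G))] [∀ γ : G, BorelSpace (G ⧸ Subgroup.centralizer ({γ} : Set G))]
    (hG : ∀ g : G, modularCharacterFun g = 1) (P : G → Prop)
    (hP : ∀ γ : G, P γ → γ ≠ 1 → ∀ g : ↥(Subgroup.centralizer ({γ} : Set G)),
      ∃ K : Subgroup ↥(Subgroup.centralizer ({γ} : Set G)), IsCompact (K : Set ↥(Subgroup.centralizer ({γ} : Set G))) ∧ g ∈ K) :
    ∃ m : OrbitalMeasureFamily G, m.IsAdmissibleOn P ∧ ∀ c : ConjClasses G, P (Quotient.out c) → (m c).Regular := by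
  obtain ⟨m, hm⟩ := exists_orbitalMeasureFamily_of_isMulRightInvariant hG P
    (fun γ hPγ ρ _ => isMulRightInvariant_centralizer_of_forall_mem_isCompact_subgroup hG γ (hP γ hPγ) ρ)
  exact ⟨m, fun c hc => ⟨(hm c hc).1, (hm c hc).2.1, (hm c hc).2.2.2⟩, fun c hc => (hm c hc).2.2.1⟩

end Generic

end Literature.NumberTheory.Automorphic

/-! ## §2 `G = U(Φ₃)(L⁺_v)`: admissible orbital measures at the unipotent classes, every finite place -/

namespace Literature.NumberTheory.Rogawski1990

open Literature.NumberTheory.Automorphic Literature.NumberTheory.Automorphic.UnitaryGroup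

variable (L : Type) [Field L] [NumberField L] [IsCMField L]

/-- **Invariant orbital measures exist at the unipotent classes of `U(Φ₃)(L⁺_v)`** (every finite place `v`): GIVEN that every element of the centraliser of
every unipotent `γ ≠ 1` lies in a compact subgroup (`hcent`; true — `G_γ` = compact torus ⋉ unipotent — and proved at the non-split places in the companion
`UnitaryThreeUnipotentCentralizerBounded`), there is an orbital-measure family on `G = U(Φ₃)(L⁺_v)` ADMISSIBLE at every class of unipotent representative
(`((γ − 1)³ = 0`): non-zero, `G`-invariant, finite on compacts — ★ `OrbitalMeasureFamily.IsAdmissibleOn`).  `G` is unimodular by ★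
`modularCharacter_cmDatum_local_antidiagOne_eq_one`. [cite: Rao1972, Theorem] [cite: Rogawski1990, §4.9 p. 54; §8.1 p. 112] [cite: DeitmarEchterhoff2014, Thm. 1.5.3] -/
theorem UnitaryGroup.exists_orbitalMeasureFamily_isAdmissibleOn_unipotent_antidiagOne_three (v : HeightOneSpectrum (𝓞 ↥(maximalRealSubfield L)))
    [MeasurableSpace ((cmDatum L 3 (Matrix.of fun i j : Fin 3 => if i.val + j.val + 1 = 3 then (1 : L) else 0)).Local v)]
    [BorelSpace ((cmDatum L 3 (Matrix.of fun i j : Fin 3 => if i.val + j.val + 1 = 3 then (1 : L) else 0)).Local v)]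
    [∀ γ : ((cmDatum L 3 (Matrix.of fun i j : Fin 3 => if i.val + j.val + 1 = 3 then (1 : L) else 0)).Local v), MeasurableSpace (((cmDatum L 3 (Matrix.of fun i j : Fin 3 => if i.val + j.val + 1 = 3 then (1 : L) else 0)).Local v) ⧸ Subgroup.centralizer ({γ} : Set ((cmDatum L 3 (Matrix.of fun i j : Fin 3 => if i.val + j.val + 1 = 3 then (1 : L) else 0)).Local v)))]
    [∀ γ : ((cmDatum L 3 (Matrix.of fun i j : Fin 3 => if i.val + j.val + 1 = 3 then (1 : L) else 0)).Local v), BorelSpace (((cmDatum L 3 (Matrix.of fun i j : Fin 3 => if i.val + j.val + 1 = 3 then (1 : L) else 0)).Local v) ⧸ Subgroup.centralizer ({γ} : Set ((cmDatum L 3 (Matrix.of fun i j : Fin 3 => if i.val + j.val + 1 = 3 then (1 : L) else 0)).Local v)))]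
    (hcent : ∀ γ : ((cmDatum L 3 (Matrix.of fun i j : Fin 3 => if i.val + j.val + 1 = 3 then (1 : L) else 0)).Local v),
      (((γ.val : GL (Fin 3) (UnitaryGroup.LocalRing L v)).val - 1) ^ 3 = 0) → γ ≠ 1 →
        ∀ g : ↥(Subgroup.centralizer ({γ} : Set ((cmDatum L 3 (Matrix.of fun i j : Fin 3 => if i.val + j.val + 1 = 3 then (1 : L) else 0)).Local v))),
          ∃ K : Subgroup ↥(Subgroup.centralizer ({γ} : Set ((cmDatum L 3 (Matrix.of fun i j : Fin 3 => if i.val + j.val + 1 = 3 then (1 : L) else 0)).Local v))),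
            IsCompact (K : Set ↥(Subgroup.centralizer ({γ} : Set ((cmDatum L 3 (Matrix.of fun i j : Fin 3 => if i.val + j.val + 1 = 3 then (1 : L) else 0)).Local v)))) ∧ g ∈ K) :
    ∃ mU : OrbitalMeasureFamily ((cmDatum L 3 (Matrix.of fun i j : Fin 3 => if i.val + j.val + 1 = 3 then (1 : L) else 0)).Local v),
      mU.IsAdmissibleOn (fun γ : ((cmDatum L 3 (Matrix.of fun i j : Fin 3 => if i.val + j.val + 1 = 3 then (1 : L) else 0)).Local v) =>
        (((γ).val : GL (Fin 3) (UnitaryGroup.LocalRing L v)).val - 1) ^ 3 = 0) ∧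
      ∀ c : ConjClasses ((cmDatum L 3 (Matrix.of fun i j : Fin 3 => if i.val + j.val + 1 = 3 then (1 : L) else 0)).Local v),
        ((((Quotient.out c : ((cmDatum L 3 (Matrix.of fun i j : Fin 3 => if i.val + j.val + 1 = 3 then (1 : L) else 0)).Local v)).val : GL (Fin 3) (UnitaryGroup.LocalRing L v)).val - 1) ^ 3 = 0) →
          (mU c).Regular :=
  exists_orbitalMeasureFamily_isAdmissibleOn_of_forall_mem_isCompact_subgroup
    (fun g => modularCharacter_cmDatum_local_antidiagOne_eq_one L 3 v g) _ hcent

/-! ## §3 The binder prefix of the Shalika pay-down organ `stub_ShRao` (odd non-split place) -/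

set_option maxHeartbeats 400000 in
-- statement-heavy: four instance binders
/-- **The existence half of the organ ‹RAO›** in the binder prefix of `stub_ShRao` (odd non-split place `v`, `w ∣ v`, `2 ∈ 𝒪_w^×` — idle for existence;
kept so that the organ closer is `obtain ⟨mU, hmU, -⟩ := …` followed by the Ranga Rao clause for this `mU`): given the centraliser property `hcent` of the
unipotent `γ ≠ 1`, an orbital-measure family on `U(Φ₃)(L⁺_v)` admissible at every unipotent class, with regular members there.
[cite: Rao1972, Theorem] [cite: Rogawski1990, §8.1 p. 112] [cite: DeitmarEchterhoff2014, Thm. 1.5.3] -/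
theorem UnitaryGroup.exists_orbitalMeasureFamily_isAdmissibleOn_unipotent_antidiagOne_three_odd :
    ∀ (L : Type) [Field L] [NumberField L] [IsCMField L] (v : HeightOneSpectrum (𝓞 ↥(maximalRealSubfield L))) (w : UnitaryGroup.PlacesOver L v),
      Subsingleton (UnitaryGroup.PlacesOver L v) → IsUnit (2 : 𝒪[w.1.adicCompletion L]) →
      ∀ [MeasurableSpace ((cmDatum L 3 (Matrix.of fun i j : Fin 3 => if i.val + j.val + 1 = 3 then (1 : L) else 0)).Local v)] [BorelSpace ((cmDatum L 3 (Matrix.of fun i j : Fin 3 => if i.val + j.val + 1 = 3 then (1 : L) else 0)).Local v)]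
        [∀ γ : ((cmDatum L 3 (Matrix.of fun i j : Fin 3 => if i.val + j.val + 1 = 3 then (1 : L) else 0)).Local v), MeasurableSpace (((cmDatum L 3 (Matrix.of fun i j : Fin 3 => if i.val + j.val + 1 = 3 then (1 : L) else 0)).Local v) ⧸ Subgroup.centralizer ({γ} : Set ((cmDatum L 3 (Matrix.of fun i j : Fin 3 => if i.val + j.val + 1 = 3 then (1 : L) else 0)).Local v)))]
        [∀ γ : ((cmDatum L 3 (Matrix.of fun i j : Fin 3 => if i.val + j.val + 1 = 3 then (1 : L) else 0)).Local v), BorelSpace (((cmDatum L 3 (Matrix.of fun i j : Fin 3 => if i.val + j.val + 1 = 3 then (1 : L) else 0)).Local v) ⧸ Subgroup.centralizer ({γ} : Set ((cmDatum L 3 (Matrix.of fun i j : Fin 3 => if i.val + j.val + 1 = 3 then (1 : L) else 0)).Local v)))],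
      (∀ γ : ((cmDatum L 3 (Matrix.of fun i j : Fin 3 => if i.val + j.val + 1 = 3 then (1 : L) else 0)).Local v),
        (((γ.val : GL (Fin 3) (UnitaryGroup.LocalRing L v)).val - 1) ^ 3 = 0) → γ ≠ 1 →
          ∀ g : ↥(Subgroup.centralizer ({γ} : Set ((cmDatum L 3 (Matrix.of fun i j : Fin 3 => if i.val + j.val + 1 = 3 then (1 : L) else 0)).Local v))),
            ∃ K : Subgroup ↥(Subgroup.centralizer ({γ} : Set ((cmDatum L 3 (Matrix.of fun i j : Fin 3 => if i.val + j.val + 1 = 3 then (1 : L) else 0)).Local v))),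
              IsCompact (K : Set ↥(Subgroup.centralizer ({γ} : Set ((cmDatum L 3 (Matrix.of fun i j : Fin 3 => if i.val + j.val + 1 = 3 then (1 : L) else 0)).Local v)))) ∧ g ∈ K) →
      ∃ mU : OrbitalMeasureFamily ((cmDatum L 3 (Matrix.of fun i j : Fin 3 => if i.val + j.val + 1 = 3 then (1 : L) else 0)).Local v),
        mU.IsAdmissibleOn (fun γ : ((cmDatum L 3 (Matrix.of fun i j : Fin 3 => if i.val + j.val + 1 = 3 then (1 : L) else 0)).Local v) =>
          (((γ).val : GL (Fin 3) (UnitaryGroup.LocalRing L v)).val - 1) ^ 3 = 0) ∧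
        ∀ c : ConjClasses ((cmDatum L 3 (Matrix.of fun i j : Fin 3 => if i.val + j.val + 1 = 3 then (1 : L) else 0)).Local v),
          ((((Quotient.out c : ((cmDatum L 3 (Matrix.of fun i j : Fin 3 => if i.val + j.val + 1 = 3 then (1 : L) else 0)).Local v)).val : GL (Fin 3) (UnitaryGroup.LocalRing L v)).val - 1) ^ 3 = 0) →
            (mU c).Regular :=
  fun L _ _ _ v _ _ _ _ _ _ _ hcent => UnitaryGroup.exists_orbitalMeasureFamily_isAdmissibleOn_unipotent_antidiagOne_three L v hcent

end Literature.NumberTheory.Rogawski1990
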